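import Literature.Computability.FineGrained.IPRenameMain
import Literature.Computability.FineGrained.IPLemma2MachineLift
import HarnessLib

/-!
# The renaming machine of Impagliazzo–Paturi's Lemma 2, XXI: the running time; the discharge

Family `fine-grained` (trunk T-CPLX-FINE). Twenty-first and last file of the machine half of
Impagliazzo–Paturi, *On the complexity of k-SAT*, JCSS 62 (2001), Lemma 2: the named fact
`Literature.Computability.FineGrained.ipRename_reduceList_computable` (`IPLemma2Assembly.lean`, the "Moreover" sentence of
Lemma 2: the renaming reduction `IPRename.reduceList` is computable within its output size) is
PROVED (`ipRename_reduceList_computable_holds'`; re-exported under the fact's own name in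
`IPLemma2AssemblyProofs.lean`). With it, Lemma 2 (`impagliazzoPaturi_lemma2`), Theorem 3
(`satExponent_le_satExponentLimit`, `s_k ≤ (1 - d/k) s_∞`) and "assuming ETH, `(s_k)` increases
infinitely often" (`ETH.frequently_satExponent_lt`) follow by `FineGrainedWave0S04Reduction.lean`.

The symbolic cost `ipMainCost` of the one-formula machine `ipMain` (`IPRenameMain.lean`,
`runs_ipMain`) is bounded by `2·10⁶ · S¹³ · (m+1)^{n/m}` in ONE size parameter
`S = (L + n + 1) + K` (`Ssz`; `K = 2^{k'} + 2^{#colours} + k + cap + m + a + b` collects the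
constants, `Kc`), whence `ComputesInTime` within `c · (m+1)^{n/m} · (L + n + 1)^c + c` steps
(`ipRename_single`, through `ACom.exists_computesInTime`) and the list fact
(`ipRename_reduceList_computable_of_single`, `IPLemma2MachineLift.lean`).

* every cost function of files I–XX is a polynomial with natural coefficients in lengths that are
  each `≤ C S^d` (`Sz.b_*`: the occurrence table `≤ 5 S²` by `length_ocTable_le`, the dictionary
  `≤ 75 S⁴`, the annotated clauses `≤ 10 S⁴`, the block table `≤ 14 S⁴`, the `Y`-table of a
  dominated vector `≤ 10 S³`, index tokens `≤ 3 S²`, `2^{|V|} ≤ S`, digit words `≤ 4 S²`, …), so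
  it is bounded by substituting the bounds (`gcongr`) and summing coefficients (`ring_nf`,
  `linarith`): `hdrCost_le`, `ytCost_le`, `fvStepCost_le`, `ocCost_le`, `dictCost_le`,
  `acCost_le`, `btCost_le`, and through the mirrors `clauseCostF` / `thetaCostF` / `emitOutF`
  (`clauseCost_eq`, `thetaCost_eq`, `emitOutCost_le_F`) the emission;
* the only non-polynomial factor is the number of `f`-vectors of a mask,
  `odoM ss ≤ (m+1)^{numNB} ≤ (m+1)^{n/m+1}` (`odoM_le_pow`, `numNB_le`), and the `2^{#colours}`
  masks are a constant (`Sz.b_masksCost`); the output length is `length_encodeList_reduceList_le`.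

## References

* R. Impagliazzo, R. Paturi, *On the complexity of k-SAT*, J. Comput. System Sci. 62 (2001)
  367–375, doi:10.1006/jcss.2000.1727, Lemma 2 (p. 373): "Moreover, F̄ can be computed from F in
  time poly(n) 2^{2εn}"; conference version: *Complexity of k-SAT*, Proc. 14th IEEE CCC (1999),
  doi:10.1109/ccc.1999.766282, Theorem 2 (p. 4), same sentence. (JCSS version not held,
  acquisition requested; CCC version held and read.)
* S. Arora, B. Barak, *Computational Complexity: A Modern Approach*, CUP 2009, §1.3 (running time
  of multi-tape machine constructions).
-/

namespace Literature.Computability.FineGrained.IPRenameM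

open _root_.Computability Complexity Complexity.ACom Sparsifier IPRename

/-! ### Polynomial bounds of the cost functions in one size parameter -/

section Arith

variable (S : ℕ) (hS : 1 ≤ S)
include hS

/-- Powers of the size parameter are monotone in the exponent. [folklore] -/
theorem pw {i d : ℕ} (h : i ≤ d) : S ^ i ≤ S ^ d := Nat.pow_le_pow_right hS h

/-- `1 ≤ S ^ d`. [folklore] -/
theorem pw0 (d : ℕ) : 1 ≤ S ^ d := Nat.one_le_pow _ _ hS

/-- `S ≤ S ^ d` for `d ≥ 1`. [folklore] -/
theorem pw1 {d : ℕ} (h : 1 ≤ d) : S ≤ S ^ d := by simpa using Nat.pow_le_pow_right hS h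

/-- **`hdrCost`.** [folklore] -/
theorem hdrCost_le {n D : ℕ} (hn : n ≤ S) (hD : D ≤ 4 * S ^ 2) : hdrCost n D ≤ 250 * S ^ 2 := by
  calc hdrCost n D ≤ hdrCost S (4 * S ^ 2) := by unfold hdrCost; gcongr
    _ ≤ 250 * S ^ 2 := by
      have := pw1 S hS (show 1 ≤ 2 by norm_num); have := pw0 S hS 2
      unfold hdrCost; ring_nf; linarith

/-- **`ytCost`.** [folklore] -/
theorem ytCost_le {m Y q Lfv Lsz b0 : ℕ} (hm : m ≤ S) (hY : Y ≤ S) (hq : q ≤ 2 * S) (h1 : Lfv ≤ 4 * S ^ 2) (h2 : Lsz ≤ 4 * S ^ 2) (h3 : b0 ≤ S) :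
    ytCost m Y q Lfv Lsz b0 ≤ 700 * S ^ 3 := by
  calc ytCost m Y q Lfv Lsz b0 ≤ ytCost S S (2 * S) (4 * S ^ 2) (4 * S ^ 2) S := by unfold ytCost blockYCost; gcongr
    _ ≤ 700 * S ^ 3 := by
      have := pw0 S hS 3; have := pw1 S hS (show 1 ≤ 3 by norm_num); have := pw S hS (show 2 ≤ 3 by norm_num)
      unfold ytCost blockYCost; ring_nf; linarith

/-- **`fvStepCost`.** [folklore] -/
theorem fvStepCost_le {m q : ℕ} (hm : m ≤ S) (hq : q ≤ 2 * S) : fvStepCost m q ≤ 450 * S ^ 2 := by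
  calc fvStepCost m q ≤ fvStepCost S (2 * S) := by unfold fvStepCost fvK; gcongr
    _ ≤ 450 * S ^ 2 := by
      have := pw0 S hS 2; have := pw1 S hS (show 1 ≤ 2 by norm_num)
      unfold fvStepCost fvK; ring_nf; linarith

/-- **The occurrence table** (`runs_ocBuild`). [folklore] -/
theorem ocCost_le {Lf Lo Wf cap : ℕ} (h1 : Lf ≤ S) (h2 : Lo ≤ 5 * S ^ 2) (h3 : Wf ≤ S) (h4 : cap ≤ S) :
    (litOcCost Lf Lo Wf cap + 16) * Wf + 4 ≤ 8500 * S ^ 10 := by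
  calc (litOcCost Lf Lo Wf cap + 16) * Wf + 4 ≤ (litOcCost S (5 * S ^ 2) S S + 16) * S + 4 := by unfold litOcCost nvCost cK xK; gcongr
    _ ≤ 8500 * S ^ 10 := by
      have := pw0 S hS 10; have := pw1 S hS (show 1 ≤ 10 by norm_num); have := pw S hS (show 2 ≤ 10 by norm_num)
      have := pw S hS (show 3 ≤ 10 by norm_num); have := pw S hS (show 4 ≤ 10 by norm_num); have := pw S hS (show 5 ≤ 10 by norm_num)
      have := pw S hS (show 6 ≤ 10 by norm_num); have := pw S hS (show 7 ≤ 10 by norm_num); have := pw S hS (show 8 ≤ 10 by norm_num)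
      have := pw S hS (show 9 ≤ 10 by norm_num)
      unfold litOcCost nvCost cK xK; ring_nf; linarith

/-- **`dictCost`.** [folklore] -/
theorem dictCost_le {Lo m nb : ℕ} (h1 : Lo ≤ 5 * S ^ 2) (h2 : m ≤ S) (h3 : nb ≤ S) : dictCost Lo m nb ≤ 3300 * S ^ 4 := by
  calc dictCost Lo m nb ≤ dictCost (5 * S ^ 2) S S := by unfold dictCost dK; gcongr
    _ ≤ 3300 * S ^ 4 := by
      have := pw0 S hS 4; have := pw1 S hS (show 1 ≤ 4 by norm_num); have := pw S hS (show 2 ≤ 4 by norm_num)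
      have := pw S hS (show 3 ≤ 4 by norm_num)
      unfold dictCost dK; ring_nf; linarith

/-- **The annotated clauses** (`runs_acBuild`). [folklore] -/
theorem acCost_le {Lo Ld m Wf wac : ℕ} (h1 : Lo ≤ 5 * S ^ 2) (h2 : Ld ≤ 75 * S ^ 4) (h3 : m ≤ S) (h4 : Wf ≤ S) (h5 : wac ≤ 10 * S ^ 4) :
    (aK Lo Ld m + 10) * Wf + 3 * wac + 5 ≤ 16000 * S ^ 7 := by
  calc (aK Lo Ld m + 10) * Wf + 3 * wac + 5 ≤ (aK (5 * S ^ 2) (75 * S ^ 4) S + 10) * S + 3 * (10 * S ^ 4) + 5 := by unfold aK; gcongr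
    _ ≤ 16000 * S ^ 7 := by
      have := pw0 S hS 7; have := pw1 S hS (show 1 ≤ 7 by norm_num); have := pw S hS (show 2 ≤ 7 by norm_num)
      have := pw S hS (show 3 ≤ 7 by norm_num); have := pw S hS (show 4 ≤ 7 by norm_num); have := pw S hS (show 5 ≤ 7 by norm_num)
      have := pw S hS (show 6 ≤ 7 by norm_num)
      unfold aK; ring_nf; linarith

/-- **`btCost`.** [folklore] -/
theorem btCost_le {Lo Ld m Wf : ℕ} (h1 : Lo ≤ 5 * S ^ 2) (h2 : Ld ≤ 75 * S ^ 4) (h3 : m ≤ S) (h4 : Wf ≤ S) :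
    btCost Lo Ld m Wf ≤ 90000 * S ^ 9 := by
  calc btCost Lo Ld m Wf ≤ btCost (5 * S ^ 2) (75 * S ^ 4) S S := by unfold btCost bK bvarCost cKe eK; gcongr
    _ ≤ 90000 * S ^ 9 := by
      have := pw0 S hS 9; have := pw1 S hS (show 1 ≤ 9 by norm_num); have := pw S hS (show 2 ≤ 9 by norm_num)
      have := pw S hS (show 3 ≤ 9 by norm_num); have := pw S hS (show 4 ≤ 9 by norm_num); have := pw S hS (show 5 ≤ 9 by norm_num)
      have := pw S hS (show 6 ≤ 9 by norm_num); have := pw S hS (show 7 ≤ 9 by norm_num); have := pw S hS (show 8 ≤ 9 by norm_num)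
      unfold btCost bK bvarCost cKe eK; ring_nf; linarith

/-- Mirror of `cnfCost` on size parameters. [folklore] -/
def cnfCostF (I TV cE : ℕ) : ℕ := (cE + 22 * I + 12 + 2) * TV + 1

/-- Mirror of `vbK`. [folklore] -/
def vbKF (WBT WYT : ℕ) : ℕ := 20 * WBT + 22 * WYT + 24

/-- Mirror of `evKV`. [folklore] -/
def evKVF (I WBT WYT : ℕ) : ℕ := (60 * (I + 1) + 14) * (WBT + WYT) + 60 * (I + 1)

/-- Mirror of `clauseCost`. [folklore] -/
def clauseCostF (ma w I TV WBT WYT : ℕ) : ℕ :=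
  3 * ma + ((3 * ma + 1) + ((vbKF WBT WYT + 10) * ma + 3 * w + 5) + 1 + cnfCostF I TV ((evKVF I WBT WYT + 10) * ma + 7) + (2 * ma + 1) + (2 * w + 1)) + 2

/-- Mirror of `thetaCost`. [folklore] -/
def thetaCostF (i WBT w I TV WYT : ℕ) : ℕ :=
  (10 * i + 3) + (20 * WBT + 11) + (3 * w + 1) + 1 + cnfCostF I TV ((60 * (I + 1) + 19) * WBT + 42 * WYT + 51) + (2 * w + 1) + 1

/-- Mirror of `emitOutCost` with uniform bounds of the per-clause and per-block costs. [folklore] -/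
def emitOutF (wac Fl Uc WBT NB Ut : ℕ) : ℕ := (10 * wac + 3 + Fl * Uc + 1) + (10 * WBT + 3 + (NB * Ut + 2 * WBT + 1) + (2 * NB + 1))

/-- **`clauseCostF`.** [folklore] -/
theorem clauseCostF_le {ma w I TV WBT WYT : ℕ} (h1 : ma ≤ 9 * S ^ 3) (h2 : w ≤ 3 * S ^ 2) (h3 : I ≤ 3 * S ^ 2) (h4 : TV ≤ S) (h5 : WBT ≤ 14 * S ^ 4)
    (h6 : WYT ≤ 10 * S ^ 3) : clauseCostF ma w I TV WBT WYT ≤ 130000 * S ^ 10 := by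
  calc clauseCostF ma w I TV WBT WYT ≤ clauseCostF (9 * S ^ 3) (3 * S ^ 2) (3 * S ^ 2) S (14 * S ^ 4) (10 * S ^ 3) := by
        unfold clauseCostF cnfCostF vbKF evKVF; gcongr
    _ ≤ 130000 * S ^ 10 := by
      have := pw0 S hS 10; have := pw1 S hS (show 1 ≤ 10 by norm_num); have := pw S hS (show 2 ≤ 10 by norm_num)
      have := pw S hS (show 3 ≤ 10 by norm_num); have := pw S hS (show 4 ≤ 10 by norm_num); have := pw S hS (show 5 ≤ 10 by norm_num)
      have := pw S hS (show 6 ≤ 10 by norm_num); have := pw S hS (show 7 ≤ 10 by norm_num); have := pw S hS (show 8 ≤ 10 by norm_num)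
      have := pw S hS (show 9 ≤ 10 by norm_num)
      unfold clauseCostF cnfCostF vbKF evKVF; ring_nf; linarith

/-- **`thetaCostF`.** [folklore] -/
theorem thetaCostF_le {i WBT w I TV WYT : ℕ} (h0 : i ≤ 2 * S) (h5 : WBT ≤ 14 * S ^ 4) (h2 : w ≤ 3 * S ^ 2) (h3 : I ≤ 3 * S ^ 2) (h4 : TV ≤ S)
    (h6 : WYT ≤ 10 * S ^ 3) : thetaCostF i WBT w I TV WYT ≤ 10000 * S ^ 7 := by
  calc thetaCostF i WBT w I TV WYT ≤ thetaCostF (2 * S) (14 * S ^ 4) (3 * S ^ 2) (3 * S ^ 2) S (10 * S ^ 3) := by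
        unfold thetaCostF cnfCostF; gcongr
    _ ≤ 10000 * S ^ 7 := by
      have := pw0 S hS 7; have := pw1 S hS (show 1 ≤ 7 by norm_num); have := pw S hS (show 2 ≤ 7 by norm_num)
      have := pw S hS (show 3 ≤ 7 by norm_num); have := pw S hS (show 4 ≤ 7 by norm_num); have := pw S hS (show 5 ≤ 7 by norm_num)
      have := pw S hS (show 6 ≤ 7 by norm_num)
      unfold thetaCostF cnfCostF; ring_nf; linarith

/-- **`emitOutF`.** [folklore] -/
theorem emitOutF_le {wac Fl Uc WBT NB Ut : ℕ} (h1 : wac ≤ 10 * S ^ 4) (h2 : Fl ≤ S) (h3 : Uc ≤ 130000 * S ^ 10) (h4 : WBT ≤ 14 * S ^ 4)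
    (h5 : NB ≤ 2 * S) (h6 : Ut ≤ 10000 * S ^ 7) : emitOutF wac Fl Uc WBT NB Ut ≤ 200000 * S ^ 11 := by
  calc emitOutF wac Fl Uc WBT NB Ut ≤ emitOutF (10 * S ^ 4) S (130000 * S ^ 10) (14 * S ^ 4) (2 * S) (10000 * S ^ 7) := by
        unfold emitOutF; gcongr
    _ ≤ 200000 * S ^ 11 := by
      have := pw0 S hS 11; have := pw1 S hS (show 1 ≤ 11 by norm_num); have := pw S hS (show 4 ≤ 11 by norm_num)
      have := pw S hS (show 8 ≤ 11 by norm_num)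
      unfold emitOutF; ring_nf; linarith

/-- **`mkThrCost`.** [folklore] -/
theorem mkThrCost_le {a b n : ℕ} (ha : a ≤ S) (hb : b ≤ S) (hn : n ≤ S) : mkThrCost a b n ≤ 100 * S ^ 3 := by
  have hdiv : (a * n + b - 1) / b ≤ a * n + b := (Nat.div_le_self _ _).trans (Nat.sub_le _ _)
  calc mkThrCost a b n ≤ (10 * n + 3) + ((a + 2) * n + 1) + b + ((2 * b + 4) * (a * n + b + 1) + 2) := by
        unfold mkThrCost; gcongr; exact Nat.sub_le _ _
    _ ≤ (10 * S + 3) + ((S + 2) * S + 1) + S + ((2 * S + 4) * (S * S + S + 1) + 2) := by gcongr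
    _ ≤ 100 * S ^ 3 := by
      have := pw0 S hS 3; have := pw1 S hS (show 1 ≤ 3 by norm_num); have := pw S hS (show 2 ≤ 3 by norm_num)
      ring_nf; linarith

/-- **`parseCost`.** [folklore] -/
theorem parseCost_le {a b n H W : ℕ} (ha : a ≤ S) (hb : b ≤ S) (hn : n ≤ S) (hH : H ≤ S) (hW : W ≤ S) : parseCost a b n H W ≤ 200 * S ^ 3 := by
  have h1 := mkThrCost_le S hS ha hb hn
  calc parseCost a b n H W = (6 * (H + 1) + 2) + ((10 * n + 5) * H + 1) + mkThrCost a b n + (3 * W + 1) + (3 * W + 1) := rfl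
    _ ≤ (6 * (S + 1) + 2) + ((10 * S + 5) * S + 1) + 100 * S ^ 3 + (3 * S + 1) + (3 * S + 1) := by gcongr
    _ ≤ 200 * S ^ 3 := by
      have := pw0 S hS 3; have := pw1 S hS (show 1 ≤ 3 by norm_num); have := pw S hS (show 2 ≤ 3 by norm_num)
      ring_nf; linarith

end Arith

/-! ### Lengths of the machine's words -/

section Lengths

variable {k : ℕ} (φ : KCNF k)

/-- The clause word is part of the encoding. [folklore] -/
theorem length_wFam_le_encode : (wFam φ.clauses).length ≤ φ.encode.length := by
  have : φ.encode = bitsN φ.numVars ++ Γ'.comma :: wFam φ.clauses := rfl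
  rw [this, List.length_append, List.length_cons]; omega

/-- The occurring variables are at most `n`. [folklore] -/
theorem length_occList_le : (occList φ.clauses).length ≤ φ.numVars := by
  rw [length_occList]; exact card_occVars_le φ

/-- `B` has at most `n` variables. [folklore] -/
theorem length_bList_le (P : Params) : (bList P φ.clauses).length ≤ φ.numVars :=
  (List.length_filter_le _ _).trans (length_occList_le φ)

/-- `A` has at most `n` variables. [folklore] -/
theorem length_aList_le (P : Params) : (aList P φ.clauses).length ≤ φ.numVars :=
  (List.length_filter_le _ _).trans (length_occList_le φ)

omit φ in
/-- A colour is at most the number of occurring variables. [folklore] -/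
theorem col_le_length_occList (F : List (List (ℕ × Bool))) (cap x : ℕ) : col F cap x ≤ (occList F).length := by
  rw [col]
  refine (freshNat_le_card _).trans ((List.toFinset_card_le _).trans ((List.length_filterMap_le _ _).trans ?_))
  rw [List.length_attach, pre]
  exact List.length_take_le' _ _

/-- **The occurrence table has length at most `n (2n + 3)`.** [folklore] -/
theorem length_ocTable_le (cap : ℕ) : (wRecs (ocRecs φ.clauses cap (occList φ.clauses))).length ≤ φ.numVars * (2 * φ.numVars + 3) := by
  have hocc := length_occList_le φ
  unfold wRecs ocRecs
  rw [List.flatMap_map, List.length_flatMap]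
  have hb : ∀ x ∈ (occList φ.clauses).map (fun z => ((encodeNat z).map Γ'.bit ++ Γ'.comma :: (ocPay φ.clauses cap z ++ [Γ'.blank])).length),
      x ≤ 2 * φ.numVars + 3 := by
    intro x hx
    obtain ⟨z, hz, rfl⟩ := List.mem_map.1 hx
    have hzn : z < φ.numVars := KCNF.lt_numVars_of_mem_occVars (mem_occList.1 hz)
    have h1 : (encodeNat z).length ≤ z := TokConv.length_encodeNat_le z
    have h2 : col φ.clauses cap z ≤ φ.numVars := (col_le_length_occList _ _ _).trans hocc
    simp only [List.length_append, List.length_map, List.length_cons, ocPay, List.length_replicate, List.length_nil]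
    omega
  refine (List.sum_le_card_nsmul _ _ hb).trans ?_
  rw [List.length_map, smul_eq_mul]
  exact Nat.mul_le_mul_right _ hocc

omit φ in
/-- The word of an annotated literal. [folklore] -/
theorem length_wALit_annLit_le (P : Params) (F : List (List (ℕ × Bool))) (Lo : ℕ) (hLo : (wRecs (ocRecs F P.cap (occList F))).length ≤ Lo)
    (l : ℕ × Bool) : (wALit (annLit P F l)).length ≤ Lo + bsz P + 3 := by
  rw [← bit_cons_dpay, List.length_cons]
  have := length_dpay_le P F Lo hLo l.1
  omega

omit φ in
/-- The annotated word of a clause of width `≤ k`. [folklore] -/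
theorem length_aclW_le (P : Params) (F : List (List (ℕ × Bool))) (Lo : ℕ) (hLo : (wRecs (ocRecs F P.cap (occList F))).length ≤ Lo)
    {c : List (ℕ × Bool)} (hc : c.length ≤ k) : (aclW P F c).length ≤ k * (Lo + bsz P + 3) := by
  unfold aclW
  rw [List.flatMap_map, List.length_flatMap]
  refine (List.sum_le_card_nsmul _ (Lo + bsz P + 3) fun x hx => ?_).trans ?_
  · obtain ⟨l, -, rfl⟩ := List.mem_map.1 hx
    exact length_wALit_annLit_le P F Lo hLo l
  · rw [List.length_map, smul_eq_mul]; exact Nat.mul_le_mul_right _ hc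

omit φ in
/-- **The annotated clause list.** [folklore] -/
theorem length_wAC_le (P : Params) (F : List (List (ℕ × Bool))) (Lo : ℕ) (hLo : (wRecs (ocRecs F P.cap (occList F))).length ≤ Lo)
    (hk : ∀ c ∈ F, c.length ≤ k) : (wAC P F).length ≤ F.length * (k * (Lo + bsz P + 3) + 1) := by
  unfold wAC
  rw [List.length_flatMap]
  refine (List.sum_le_card_nsmul _ (k * (Lo + bsz P + 3) + 1) fun x hx => ?_).trans (by rw [List.length_map, smul_eq_mul])
  obtain ⟨c, hc, rfl⟩ := List.mem_map.1 hx
  rw [wAClause_eq, List.length_append, List.length_singleton]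
  exact Nat.add_le_add_right (length_aclW_le P F Lo hLo (hk c hc)) _

omit φ in
/-- **The block table.** [folklore] -/
theorem length_wBT_le (P : Params) (F : List (List (ℕ × Bool))) (Lo : ℕ) (hLo : (wRecs (ocRecs F P.cap (occList F))).length ≤ Lo) :
    (wBT (btab P F)).length ≤ 1 + (bList P F).length * ((Lo + 6) * (wFam F).length + 2) := by
  rw [← btOut_eq, btOut, List.length_reverse, List.length_append]
  have := length_outS_le P F Lo hLo (bList P F) 0 []
  rw [List.length_nil, Nat.zero_add] at this
  split_ifs <;> simp <;> omega

omit φ in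
/-- **The `Y`-table** of a dominated vector. [folklore] -/
theorem length_wYT_le (P : Params) (F : List (List (ℕ × Bool))) {ds ss : List ℕ} {m Y : ℕ} (hfv : P.fv = ds.reverse)
    (hss : ss = (sizesNB P F).reverse) (hdom : List.Forall₂ (· ≤ ·) ds ss) (hm : ∀ s ∈ ss, s ≤ m) (hY : (aList P F).length + ss.sum ≤ Y) :
    (wYT (ytab P F)).length ≤ ss.length * (m + 2 + m * (Y + 1)) := by
  rw [← ytW_eq_wYT' P F hfv hss hdom]
  have := length_ytW_le m Y ds.reverse ss.reverse (aList P F).length (List.forall₂_reverse_iff.2 hdom)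
    (fun s hs => hm s (List.mem_reverse.1 hs)) (by rwa [List.sum_reverse])
  rwa [List.length_reverse, hdom.length_eq] at this

omit φ in
/-- The index tokens of variables `≤ n`. [folklore] -/
theorem idxLen_le {V : List ℕ} {n : ℕ} (h : ∀ v ∈ V, v ≤ n) : idxLen V ≤ V.length * (n + 2) := by
  unfold idxLen
  refine (List.sum_le_card_nsmul _ (n + 2) fun x hx => ?_).trans (by rw [List.length_map, smul_eq_mul])
  obtain ⟨v, hv, rfl⟩ := List.mem_map.1 hx
  have := TokConv.length_encodeNat_le v
  have := h v hv
  omega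

/-- The new indices read by a substituted clause are at most `n`. [folklore] -/
theorem le_of_mem_depClause (P : Params) {c : List (ℕ × Bool)} (hc : c ∈ φ.clauses) {v : ℕ} (hv : v ∈ depClause P φ.clauses c) :
    v ≤ φ.numVars := by
  have h1 := lt_of_mem_depClause P φ.clauses hc hv
  have h2 := yOff_numBlocks_add_fSum P φ.clauses
  have h3 := card_occVars_le φ
  omega

/-- The new indices read by a slice constraint are at most `n`. [folklore] -/
theorem le_of_mem_depTheta (P : Params) {i v : ℕ} (hv : v ∈ depTheta P φ.clauses i) : v ≤ φ.numVars := by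
  have h1 := lt_of_mem_depTheta P φ.clauses hv
  have h2 := yOff_numBlocks_add_fSum P φ.clauses
  have h3 := card_occVars_le φ
  omega

omit φ in
/-- The initial tuple register of a dependency list. [folklore] -/
theorem length_cbody_map_false (V : List ℕ) : (cbody (V.map fun v => (v, false))).length = idxLen V := by
  rw [← zip_replicate_false, length_cbody_zip V _ (List.length_replicate ..)]

omit φ in
/-- The number of vectors of the odometer. [folklore] -/
theorem odoM_le_pow {ss : List ℕ} {m : ℕ} (hm : ∀ s ∈ ss, s ≤ m) : odoM ss ≤ (m + 1) ^ ss.length := by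
  rw [odoM_eq_prod]
  have := List.prod_le_pow_card (ss.map (· + 1)) (m + 1) (fun x hx => by
    obtain ⟨s, hs, rfl⟩ := List.mem_map.1 hx; exact Nat.succ_le_succ (hm s hs))
  rwa [List.length_map] at this

/-- The number of nonempty blocks. [folklore] -/
theorem numNB_le (P : Params) : numNB P φ.clauses ≤ φ.numVars / bsz P + 1 :=
  (numNB_le_div_add_one P _).trans (Nat.add_le_add_right (Nat.div_le_div_right (length_bList_le φ P)) _)

end Lengths

/-! ### The emission costs through their mirrors -/

/-- `clauseCost` is its mirror on the lengths. [folklore] -/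
theorem clauseCost_eq (P : Params) (F : List (List (ℕ × Bool))) (c : List (ℕ × Bool)) :
    clauseCost P F c = clauseCostF (aclW P F c).length (cbody ((depClause P F c).map fun v => (v, false))).length (idxLen (depClause P F c))
      (2 ^ (depClause P F c).length) (wBT (btab P F)).length (wYT (ytab P F)).length := by
  simp only [clauseCost, clauseCostF, cnfCost, cnfCostF, vbK, vbKF, evKV, evKVF]

/-- `thetaCost` is its mirror on the lengths. [folklore] -/
theorem thetaCost_eq (P : Params) (F : List (List (ℕ × Bool))) (i : ℕ) :
    thetaCost P F i = thetaCostF i (wBT (btab P F)).length (cbody ((depTheta P F i).map fun v => (v, false))).length (idxLen (depTheta P F i))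
      (2 ^ (depTheta P F i).length) (wYT (ytab P F)).length := by
  simp only [thetaCost, thetaCostF, cnfCost, cnfCostF]

/-- `emitOutCost` under uniform bounds of the per-clause and per-block costs. [folklore] -/
theorem emitOutCost_le_F (P : Params) (F : List (List (ℕ × Bool))) (Uc Ut : ℕ) (hc : ∀ c ∈ F, clauseCost P F c ≤ Uc)
    (ht : ∀ i < numNB P F, thetaCost P F i ≤ Ut) :
    emitOutCost P F ≤ emitOutF (wAC P F).length F.length Uc (wBT (btab P F)).length (numNB P F) Ut := by
  have h1 : (F.map (clauseCost P F)).sum ≤ F.length * Uc := by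
    refine (List.sum_le_card_nsmul _ Uc fun x hx => ?_).trans (by rw [List.length_map, smul_eq_mul])
    obtain ⟨c, hcF, rfl⟩ := List.mem_map.1 hx; exact hc c hcF
  have h2 : ((List.range (numNB P F)).map (thetaCost P F)).sum ≤ numNB P F * Ut := by
    refine (List.sum_le_card_nsmul _ Ut fun x hx => ?_).trans (by rw [List.length_map, List.length_range, smul_eq_mul])
    obtain ⟨i, hi, rfl⟩ := List.mem_map.1 hx; exact ht i (List.mem_range.1 hi)
  unfold emitOutCost emitOutF
  omega


/-! ### The size parameter of a formula -/

/-- The constants of the machine for the parameters `k, cap, len, a, b`, as one number. [folklore] -/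
def Kc (k cap len a b : ℕ) : ℕ := 2 ^ kOut k cap len + 2 ^ numCols k cap + k + cap + max len 1 + a + b

/-- **The size parameter** of a formula: input length plus number of variables plus the constants.
[folklore] -/
def Ssz (k cap len a b : ℕ) (φ : KCNF k) : ℕ := (φ.encode.length + φ.numVars + 1) + Kc k cap len a b

/-- What the bounds below use of the size parameter. [folklore] -/
structure Sz (S k cap len a b : ℕ) (φ : KCNF k) : Prop where
  /-- positive -/
  one : 1 ≤ S
  /-- bounds `L + n + 1` -/
  N : φ.encode.length + φ.numVars + 1 ≤ S
  /-- bounds the width -/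
  hk : k ≤ S
  /-- bounds the cap -/
  hcap : cap ≤ S
  /-- bounds the block length -/
  hm : max len 1 ≤ S
  /-- bounds `a` -/
  ha : a ≤ S
  /-- bounds `b` -/
  hb : b ≤ S
  /-- bounds `2 ^ k'` -/
  K0 : 2 ^ kOut k cap len ≤ S
  /-- bounds the number of masks -/
  nc : 2 ^ numCols k cap ≤ S

/-- The size parameter has the required properties. [folklore] -/
theorem sz_Ssz (k cap len a b : ℕ) (φ : KCNF k) : Sz (Ssz k cap len a b φ) k cap len a b φ := by
  unfold Ssz Kc
  generalize hA : 2 ^ kOut k cap len = A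
  generalize hB : 2 ^ numCols k cap = B
  generalize hM : max len 1 = M
  exact { one := by omega, N := by omega, hk := by omega, hcap := by omega, hm := by rw [hM]; omega, ha := by omega, hb := by omega,
          K0 := by rw [hA]; omega, nc := by rw [hB]; omega }

section SzBounds

variable {S k cap len a b : ℕ} {φ : KCNF k} (h : Sz S k cap len a b φ)
include h

/-- `n ≤ S`. [folklore] -/
theorem Sz.b_n : φ.numVars ≤ S := by have := h.N; omega

/-- `L ≤ S`. [folklore] -/
theorem Sz.b_L : φ.encode.length ≤ S := by have := h.N; omega

/-- The clause word. [folklore] -/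
theorem Sz.b_Wf : (wFam φ.clauses).length ≤ S := (length_wFam_le_encode φ).trans h.b_L

/-- The number of clauses. [folklore] -/
theorem Sz.b_Fl : φ.clauses.length ≤ S := (KCNF.length_clauses_le_length_encode φ).trans h.b_L

/-- `k' ≤ S`. [folklore] -/
theorem Sz.b_kOut : kOut k cap len ≤ S := (Nat.lt_two_pow_self).le.trans h.K0

/-- The occurrence table. [folklore] -/
theorem Sz.b_Lo : (wRecs (ocRecs φ.clauses cap (occList φ.clauses))).length ≤ 5 * S ^ 2 := by
  refine (length_ocTable_le φ cap).trans ?_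
  have := h.b_n
  calc φ.numVars * (2 * φ.numVars + 3) ≤ S * (2 * S + 3) := by gcongr
    _ ≤ 5 * S ^ 2 := by have := h.one; nlinarith

/-- The threshold. [folklore] -/
theorem Sz.b_t : ipThreshold a b φ.numVars ≤ 2 * S ^ 2 := by
  unfold ipThreshold
  refine ((Nat.div_le_self _ _).trans (Nat.sub_le _ _)).trans ?_
  have := h.ha; have := h.hb; have := h.b_n; have := h.one
  calc a * φ.numVars + b ≤ S * S + S := by gcongr
    _ ≤ 2 * S ^ 2 := by nlinarith

variable (mask : ℕ → Bool)

/-- The dictionary of a mask. [folklore] -/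
theorem Sz.b_Ld (fvB : List ℕ) : (wRecs (dictRecs (Pof cap len mask fvB) φ.clauses (occList φ.clauses))).length ≤ 75 * S ^ 4 := by
  refine (length_wRecs_dictRecs_le (Pof cap len mask fvB) φ.clauses (5 * S ^ 2) h.b_Lo).trans ?_
  have hm : bsz (Pof cap len mask fvB) ≤ S := h.hm
  calc 5 * S ^ 2 * (2 * (5 * S ^ 2) + bsz (Pof cap len mask fvB) + 4) ≤ 5 * S ^ 2 * (2 * (5 * S ^ 2) + S + 4) := by gcongr
    _ ≤ 75 * S ^ 4 := by have := h.one; have := pw1 S h.one (show 1 ≤ 2 by norm_num); nlinarith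

/-- The annotated word of a clause of the formula. [folklore] -/
theorem Sz.b_aclW (fvB : List ℕ) {c : List (ℕ × Bool)} (hc : c ∈ φ.clauses) : (aclW (Pof cap len mask fvB) φ.clauses c).length ≤ 9 * S ^ 3 := by
  refine (length_aclW_le (Pof cap len mask fvB) φ.clauses (5 * S ^ 2) h.b_Lo (φ.length_le c hc)).trans ?_
  have hm : bsz (Pof cap len mask fvB) ≤ S := h.hm
  have := h.hk
  calc k * (5 * S ^ 2 + bsz (Pof cap len mask fvB) + 3) ≤ S * (5 * S ^ 2 + S + 3) := by gcongr
    _ ≤ 9 * S ^ 3 := by have := h.one; have := pw1 S h.one (show 1 ≤ 2 by norm_num); nlinarith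

/-- The annotated clause list of a mask. [folklore] -/
theorem Sz.b_wAC (fvB : List ℕ) : (wAC (Pof cap len mask fvB) φ.clauses).length ≤ 10 * S ^ 4 := by
  refine (length_wAC_le (Pof cap len mask fvB) φ.clauses (5 * S ^ 2) h.b_Lo φ.length_le).trans ?_
  have hm : bsz (Pof cap len mask fvB) ≤ S := h.hm
  have := h.hk; have := h.b_Fl
  calc φ.clauses.length * (k * (5 * S ^ 2 + bsz (Pof cap len mask fvB) + 3) + 1) ≤ S * (S * (5 * S ^ 2 + S + 3) + 1) := by gcongr
    _ ≤ 10 * S ^ 4 := by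
      have := h.one; have := pw1 S h.one (show 1 ≤ 4 by norm_num); have := pw S h.one (show 2 ≤ 4 by norm_num); have := pw S h.one (show 3 ≤ 4 by norm_num)
      ring_nf; linarith

/-- The block table of a mask. [folklore] -/
theorem Sz.b_wBT (fvB : List ℕ) : (wBT (btab (Pof cap len mask fvB) φ.clauses)).length ≤ 14 * S ^ 4 := by
  refine (length_wBT_le (Pof cap len mask fvB) φ.clauses (5 * S ^ 2) h.b_Lo).trans ?_
  have := h.b_Wf; have := length_bList_le φ (Pof cap len mask fvB); have := h.b_n
  calc 1 + (bList (Pof cap len mask fvB) φ.clauses).length * ((5 * S ^ 2 + 6) * (wFam φ.clauses).length + 2)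
      ≤ 1 + S * ((5 * S ^ 2 + 6) * S + 2) := by gcongr; omega
    _ ≤ 14 * S ^ 4 := by
      have := pw0 S h.one 4; have := pw1 S h.one (show 1 ≤ 4 by norm_num); have := pw S h.one (show 2 ≤ 4 by norm_num); have := pw S h.one (show 3 ≤ 4 by norm_num)
      ring_nf; linarith

/-- The number of nonempty blocks. [folklore] -/
theorem Sz.b_numNB (fvB : List ℕ) : numNB (Pof cap len mask fvB) φ.clauses ≤ 2 * S := by
  refine (numNB_le φ (Pof cap len mask fvB)).trans ?_
  have := Nat.div_le_self φ.numVars (bsz (Pof cap len mask fvB)); have := h.b_n; have := h.one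
  omega

/-- The machine-order sizes of a mask. [folklore] -/
theorem Sz.b_ss : (ssOf cap len mask φ.clauses).length ≤ 2 * S := by
  rw [ssOf, List.length_reverse]; simpa [sizesNB] using h.b_numNB mask []

/-- The `Y`-table of a dominated vector of a mask. [folklore] -/
theorem Sz.b_wYT {ds : List ℕ} (hdom : List.Forall₂ (· ≤ ·) ds (ssOf cap len mask φ.clauses)) :
    (wYT (ytab (Pof cap len mask ds.reverse) φ.clauses)).length ≤ 10 * S ^ 3 := by
  set P := Pof cap len mask ds.reverse with hP
  have hmss : ∀ s ∈ ssOf cap len mask φ.clauses, s ≤ bsz P := fun s hs => le_bsz_of_mem_sizesNB P φ.clauses (List.mem_reverse.1 hs)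
  have hY : (aList P φ.clauses).length + (ssOf cap len mask φ.clauses).sum ≤ φ.numVars := by
    rw [ssOf, List.sum_reverse, show sizesNB (Pof cap len mask []) φ.clauses = sizesNB P φ.clauses from rfl, sum_sizesNB,
      length_aList_add_length_bList]
    exact card_occVars_le φ
  refine (length_wYT_le P φ.clauses rfl rfl hdom hmss hY).trans ?_
  have h1 := h.b_ss mask; have hm : bsz P ≤ S := h.hm; have := h.b_n
  calc (ssOf cap len mask φ.clauses).length * (bsz P + 2 + bsz P * (φ.numVars + 1)) ≤ 2 * S * (S + 2 + S * (S + 1)) := by gcongr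
    _ ≤ 10 * S ^ 3 := by
      have := pw0 S h.one 3; have := pw1 S h.one (show 1 ≤ 3 by norm_num); have := pw S h.one (show 2 ≤ 3 by norm_num)
      ring_nf; linarith

/-- The index tokens of a dependency list. [folklore] -/
theorem Sz.b_idxLen {V : List ℕ} (hV : ∀ v ∈ V, v ≤ φ.numVars) (hlen : V.length ≤ IPRename.kOut k cap len) : idxLen V ≤ 3 * S ^ 2 := by
  refine (idxLen_le hV).trans ?_
  have := h.b_kOut; have := h.b_n
  calc V.length * (φ.numVars + 2) ≤ S * (S + 2) := by gcongr; omega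
    _ ≤ 3 * S ^ 2 := by have := h.one; nlinarith

/-- The number of tuples of a dependency list. [folklore] -/
theorem Sz.b_TV {V : List ℕ} (hlen : V.length ≤ IPRename.kOut k cap len) : 2 ^ V.length ≤ S :=
  (Nat.pow_le_pow_right (by norm_num) hlen).trans h.K0

/-- A digit word of a mask. [folklore] -/
theorem Sz.b_dW {ds : List ℕ} (hds : ∀ d ∈ ds, d ≤ max len 1) (hl : ds.length ≤ 2 * S) : (dW ds).length ≤ 4 * S ^ 2 := by
  refine (length_dW_le (max len 1) ds hds).trans ?_
  have := h.hm
  calc (max len 1 + 1) * ds.length ≤ (S + 1) * (2 * S) := by gcongr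
    _ ≤ 4 * S ^ 2 := by have := h.one; nlinarith

end SzBounds

/-! ### The cost of one vector, of one mask, of all masks -/

section VecBound

variable {S k cap len a b : ℕ} {φ : KCNF k} (h : Sz S k cap len a b φ) (mask : ℕ → Bool)
include h

/-- **A substituted clause of a dominated vector.** [folklore] -/
theorem Sz.b_clauseCost {ds : List ℕ} (hdom : List.Forall₂ (· ≤ ·) ds (ssOf cap len mask φ.clauses)) {c : List (ℕ × Bool)} (hc : c ∈ φ.clauses) :
    clauseCost (Pof cap len mask ds.reverse) φ.clauses c ≤ 130000 * S ^ 10 := by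
  have hV : ∀ v ∈ depClause (Pof cap len mask ds.reverse) φ.clauses c, v ≤ φ.numVars := fun v hv => le_of_mem_depClause φ _ hc hv
  have hVl : (depClause (Pof cap len mask ds.reverse) φ.clauses c).length ≤ IPRename.kOut k cap len := length_depClause_le _ _ φ.length_le hc
  rw [clauseCost_eq, length_cbody_map_false]
  exact clauseCostF_le S h.one (h.b_aclW mask ds.reverse hc) (h.b_idxLen hV hVl) (h.b_idxLen hV hVl) (h.b_TV hVl) (h.b_wBT mask ds.reverse) (h.b_wYT mask hdom)

/-- **A slice constraint of a dominated vector.** [folklore] -/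
theorem Sz.b_thetaCost {ds : List ℕ} (hdom : List.Forall₂ (· ≤ ·) ds (ssOf cap len mask φ.clauses)) {i : ℕ}
    (hi : i < numNB (Pof cap len mask ds.reverse) φ.clauses) : thetaCost (Pof cap len mask ds.reverse) φ.clauses i ≤ 10000 * S ^ 7 := by
  have hV : ∀ v ∈ depTheta (Pof cap len mask ds.reverse) φ.clauses i, v ≤ φ.numVars := fun v hv => le_of_mem_depTheta φ _ hv
  have hVl : (depTheta (Pof cap len mask ds.reverse) φ.clauses i).length ≤ IPRename.kOut k cap len := length_depTheta_le_kOut _ _ φ.length_le i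
  rw [thetaCost_eq, length_cbody_map_false]
  exact thetaCostF_le S h.one (hi.le.trans (h.b_numNB mask ds.reverse)) (h.b_wBT mask ds.reverse) (h.b_idxLen hV hVl) (h.b_idxLen hV hVl) (h.b_TV hVl) (h.b_wYT mask hdom)

/-- **The clauses of a dominated vector.** [folklore] -/
theorem Sz.b_emitOutCost {ds : List ℕ} (hdom : List.Forall₂ (· ≤ ·) ds (ssOf cap len mask φ.clauses)) :
    emitOutCost (Pof cap len mask ds.reverse) φ.clauses ≤ 200000 * S ^ 11 :=
  (emitOutCost_le_F _ _ _ _ (fun _ hc => h.b_clauseCost mask hdom hc) (fun _ hi => h.b_thetaCost mask hdom hi)).trans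
    (emitOutF_le S h.one (h.b_wAC mask ds.reverse) h.b_Fl le_rfl (h.b_wBT mask ds.reverse) (h.b_numNB mask ds.reverse) le_rfl)

/-- **One iteration of the loop over the vectors.** [folklore] -/
theorem Sz.b_vecBodyCost {i : ℕ} :
    vecBodyCost cap len mask φ.clauses φ.numVars (ipThreshold a b φ.numVars) (max len 1) (occVars φ.clauses).card (ssOf cap len mask φ.clauses) i ≤
      300000 * S ^ 11 := by
  set ss := ssOf cap len mask φ.clauses with hss
  set ds := odoAt ss i with hds
  have hdom : List.Forall₂ (· ≤ ·) ds ss := odoAt_le ss i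
  have hlen : ds.length = ss.length := hdom.length_eq
  have hmss : ∀ s ∈ ss, s ≤ max len 1 := fun s hs => le_bsz_of_mem_sizesNB (Pof cap len mask []) φ.clauses (List.mem_reverse.1 hs)
  have hmds : ∀ d ∈ ds, d ≤ max len 1 := fun d hd => by
    obtain ⟨j, hj, rfl⟩ := List.getElem_of_mem hd
    exact (hdom.get hj (by omega)).trans (hmss _ (List.getElem_mem _))
  have hS1 := h.one
  have hdsl : ds.length ≤ 2 * S := by rw [hlen]; exact h.b_ss mask
  have e1 := hdrCost_le S hS1 h.b_n (h.b_dW hmds hdsl)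
  have e2 := ytCost_le S hS1 h.hm ((card_occVars_le φ).trans h.b_n) hdsl (h.b_dW hmds hdsl) (h.b_dW hmss (h.b_ss mask))
    ((length_bitsN_le (aList (Pof cap len mask ds.reverse) φ.clauses).length).trans ((length_aList_le φ (Pof cap len mask ds.reverse)).trans h.b_n))
  have e3 := h.b_emitOutCost mask hdom
  have e4 := h.b_wYT mask hdom
  have e5 := h.b_dW hmds hdsl
  have e6 := h.b_t
  have e7 := fvStepCost_le S hS1 h.hm (h.b_ss mask)
  have p2 := pw S hS1 (show 2 ≤ 11 by norm_num); have p3 := pw S hS1 (show 3 ≤ 11 by norm_num); have p0 := pw0 S hS1 11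
  unfold IPRenameM.vecBodyCost IPRenameM.vecStepCost IPRenameM.vecEmitCost
  rw [← hds]
  linarith

/-- The number of vectors of a mask. [folklore] -/
theorem Sz.b_odoM : odoM (ssOf cap len mask φ.clauses) ≤ 2 * S * (max len 1 + 1) ^ (φ.numVars / max len 1) := by
  set ss := ssOf cap len mask φ.clauses with hss
  have hmss : ∀ s ∈ ss, s ≤ max len 1 := fun s hs => le_bsz_of_mem_sizesNB (Pof cap len mask []) φ.clauses (List.mem_reverse.1 hs)
  refine (odoM_le_pow hmss).trans ?_
  have hl : ss.length ≤ φ.numVars / max len 1 + 1 := by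
    rw [hss, ssOf, List.length_reverse]; simpa [sizesNB, bsz] using numNB_le φ (Pof cap len mask [])
  refine (Nat.pow_le_pow_right (Nat.succ_pos _) hl).trans ?_
  rw [pow_succ]
  have := h.hm
  calc (max len 1 + 1) ^ (φ.numVars / max len 1) * (max len 1 + 1) ≤ (max len 1 + 1) ^ (φ.numVars / max len 1) * (2 * S) :=
        Nat.mul_le_mul_left _ (by omega)
    _ = _ := by ring

/-- **The loop over the vectors of a mask.** [folklore] -/
theorem Sz.b_vecLoopCost :
    vecLoopCost cap len mask φ.clauses φ.numVars (ipThreshold a b φ.numVars) (max len 1) (occVars φ.clauses).card (ssOf cap len mask φ.clauses) ≤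
      700000 * (S ^ 12 * (max len 1 + 1) ^ (φ.numVars / max len 1)) := by
  set G := (max len 1 + 1) ^ (φ.numVars / max len 1) with hG
  have hG1 : 1 ≤ G := Nat.one_le_pow _ _ (Nat.succ_pos _)
  have hsup : (Finset.range (IPRenameM.odoM (ssOf cap len mask φ.clauses))).sup
      (IPRenameM.vecBodyCost cap len mask φ.clauses φ.numVars (ipThreshold a b φ.numVars) (max len 1) (occVars φ.clauses).card (ssOf cap len mask φ.clauses)) ≤
      300000 * S ^ 11 := Finset.sup_le fun i _ => h.b_vecBodyCost mask
  have hM := h.b_odoM mask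
  have hS1 := h.one
  unfold IPRenameM.vecLoopCost
  calc ((Finset.range (IPRenameM.odoM (ssOf cap len mask φ.clauses))).sup _ + 2) * IPRenameM.odoM (ssOf cap len mask φ.clauses) + 2
      ≤ (300000 * S ^ 11 + 2) * (2 * S * G) + 2 := by gcongr
    _ ≤ 700000 * (S ^ 12 * G) := by
      have p1 : S ≤ S ^ 12 := pw1 S hS1 (show 1 ≤ 12 by norm_num)
      have p0 : 1 ≤ S ^ 12 := pw0 S hS1 12
      have q1 : S * G ≤ S ^ 12 * G := Nat.mul_le_mul_right _ p1
      have q0 : 1 ≤ S ^ 12 * G := Nat.le_mul_of_pos_right _ hG1 |>.trans' p0 |> fun h => p0.trans (Nat.le_mul_of_pos_right _ hG1)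
      have e : (300000 * S ^ 11 + 2) * (2 * S * G) + 2 = 600000 * (S ^ 12 * G) + 4 * (S * G) + 2 := by ring
      rw [e]
      linarith

/-- **One mask.** [folklore] -/
theorem Sz.b_maskCost {nb : ℕ} (hnb : nb ≤ S) :
    maskCost cap len mask φ.clauses φ.numVars (ipThreshold a b φ.numVars) (occVars φ.clauses).card (wRecs (ocRecs φ.clauses cap (occList φ.clauses))).length nb ≤
      1000000 * (S ^ 12 * (max len 1 + 1) ^ (φ.numVars / max len 1)) := by
  set G := (max len 1 + 1) ^ (φ.numVars / max len 1) with hG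
  have hG1 : 1 ≤ G := Nat.one_le_pow _ _ (Nat.succ_pos _)
  have hS1 := h.one
  have hmss : ∀ s ∈ ssOf cap len mask φ.clauses, s ≤ max len 1 := fun s hs => le_bsz_of_mem_sizesNB (Pof cap len mask []) φ.clauses (List.mem_reverse.1 hs)
  have hbz : bsz (Pof cap len mask []) ≤ S := h.hm
  have e1 := dictCost_le S hS1 h.b_Lo hbz hnb
  have e2 := acCost_le S hS1 h.b_Lo (h.b_Ld mask []) hbz h.b_Wf (h.b_wAC mask [])
  have e3 := btCost_le S hS1 h.b_Lo (h.b_Ld mask []) hbz h.b_Wf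
  have e4 := h.b_dW hmss (h.b_ss mask)
  have e5 : vecLoopCost cap len mask φ.clauses φ.numVars (ipThreshold a b φ.numVars) (bsz (Pof cap len mask [])) (occVars φ.clauses).card
      (ssOf cap len mask φ.clauses) ≤ 700000 * (S ^ 12 * G) := h.b_vecLoopCost mask
  have e6 := h.b_Ld mask []
  have e7 : (bitsN (aList (Pof cap len mask []) φ.clauses).length).length ≤ S := (length_bitsN_le _).trans ((length_aList_le φ _).trans h.b_n)
  have e8 := h.b_wAC mask []
  have e9 := h.b_wBT mask []
  have e10 := h.b_ss mask
  unfold IPRenameM.maskCost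
  calc _ ≤ 3300 * S ^ 4 + 16000 * S ^ 7 + 90000 * S ^ 9 + (13 * (4 * S ^ 2) + 4) + 700000 * (S ^ 12 * G) +
        ((2 * (75 * S ^ 4) + 1) + (2 * S + 1) + (2 * (10 * S ^ 4) + 1) + (2 * (14 * S ^ 4) + 1) + (2 * (4 * S ^ 2) + 1) + (2 * (2 * S) + 1)) := by
        gcongr
    _ ≤ 1000000 * (S ^ 12 * G) := by
      have p1 : S ≤ S ^ 12 := pw1 S hS1 (show 1 ≤ 12 by norm_num)
      have p0 : 1 ≤ S ^ 12 := pw0 S hS1 12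
      have p2 := pw S hS1 (show 2 ≤ 12 by norm_num); have p4 := pw S hS1 (show 4 ≤ 12 by norm_num); have p7 := pw S hS1 (show 7 ≤ 12 by norm_num)
      have p9 := pw S hS1 (show 9 ≤ 12 by norm_num)
      have hSG : S ^ 12 ≤ S ^ 12 * G := Nat.le_mul_of_pos_right _ hG1
      linarith

/-- **All masks.** [folklore] -/
theorem Sz.b_masksCost :
    masksCost cap len φ.clauses φ.numVars (ipThreshold a b φ.numVars) (occVars φ.clauses).card (wRecs (ocRecs φ.clauses cap (occList φ.clauses))).length
      (tuples (numCols k cap)) ≤ 1000000 * (S ^ 13 * (max len 1 + 1) ^ (φ.numVars / max len 1)) := by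
  set G := (max len 1 + 1) ^ (φ.numVars / max len 1) with hG
  have hnc : numCols k cap ≤ S := (Nat.lt_two_pow_self).le.trans h.nc
  unfold IPRenameM.masksCost
  refine (List.sum_le_card_nsmul _ (1000000 * (S ^ 12 * G)) fun x hx => ?_).trans ?_
  · obtain ⟨bs, hbs, rfl⟩ := List.mem_map.1 hx
    rw [mem_tuples.1 hbs]
    exact h.b_maskCost (maskOf bs) hnc
  · rw [List.length_map, length_tuples, smul_eq_mul]
    have := h.nc
    calc 2 ^ numCols k cap * (1000000 * (S ^ 12 * G)) ≤ S * (1000000 * (S ^ 12 * G)) := Nat.mul_le_mul_right _ this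
      _ = 1000000 * (S ^ 13 * G) := by ring

/-- **The whole machine**: `ipMainCost + 1 ≤ 2·10⁶ · S¹³ · (m+1)^{n/m}`. [folklore] -/
theorem Sz.b_ipMainCost :
    ipMainCost k cap len a b φ + 1 ≤ 2000000 * (S ^ 13 * (max len 1 + 1) ^ (φ.numVars / max len 1)) := by
  set G := (max len 1 + 1) ^ (φ.numVars / max len 1) with hG
  have hG1 : 1 ≤ G := Nat.one_le_pow _ _ (Nat.succ_pos _)
  have hS1 := h.one
  have e1 := parseCost_le S hS1 h.ha h.hb h.b_n ((TokConv.length_encodeNat_le _).trans h.b_n) h.b_Wf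
  have e2 := ocCost_le S hS1 h.b_n h.b_Lo h.b_Wf h.hcap
  have e3 := h.b_masksCost
  have e4 : (KCNF.encodeList (reduceList k cap len (ipThreshold a b φ.numVars) φ)).length ≤ 32 * (S ^ 6 * G) := by
    refine (IPRename.length_encodeList_reduceList_le k cap len _ φ).trans ?_
    rw [pow_succ]
    have := h.nc; have := h.K0; have := h.b_kOut; have := h.N; have := h.hm
    calc 2 ^ numCols k cap * (G * (max len 1 + 1)) * (4 * (2 ^ IPRename.kOut k cap len * (IPRename.kOut k cap len + 2) + 1) * (φ.encode.length + φ.numVars + 1) ^ 2)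
        ≤ S * (G * (S + 1)) * (4 * (S * (S + 2) + 1) * S ^ 2) := by gcongr
      _ ≤ 32 * (S ^ 6 * G) := by
        have : S * (G * (S + 1)) * (4 * (S * (S + 2) + 1) * S ^ 2) = (4 * S ^ 6 + 12 * S ^ 5 + 12 * S ^ 4 + 4 * S ^ 3) * G := by ring
        rw [this, show 32 * (S ^ 6 * G) = (32 * S ^ 6) * G by ring]
        refine Nat.mul_le_mul_right _ ?_
        have p3 := pw S hS1 (show 3 ≤ 6 by norm_num); have p4 := pw S hS1 (show 4 ≤ 6 by norm_num); have p5 := pw S hS1 (show 5 ≤ 6 by norm_num)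
        linarith
  have e5 := h.b_Wf; have e6 := h.b_Lo; have e7 := h.b_n; have e8 := h.b_t
  unfold IPRenameM.ipMainCost ocTable
  calc _ ≤ 200 * S ^ 3 + 8500 * S ^ 10 + 1000000 * (S ^ 13 * G) +
        ((3 * (32 * (S ^ 6 * G)) + 1) + (2 * S + 1) + (2 * (5 * S ^ 2) + 1) + (2 * S + 1) + (2 * (2 * S ^ 2) + 1)) + 1 := by
        gcongr
    _ ≤ 2000000 * (S ^ 13 * G) := by
      have p1 : S ≤ S ^ 13 := pw1 S hS1 (show 1 ≤ 13 by norm_num)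
      have p0 : 1 ≤ S ^ 13 := pw0 S hS1 13
      have p2 := pw S hS1 (show 2 ≤ 13 by norm_num); have p3 := pw S hS1 (show 3 ≤ 13 by norm_num); have p6 := pw S hS1 (show 6 ≤ 13 by norm_num)
      have p10 := pw S hS1 (show 10 ≤ 13 by norm_num)
      have hSG : S ^ 13 ≤ S ^ 13 * G := Nat.le_mul_of_pos_right _ hG1
      have hSG6 : S ^ 6 * G ≤ S ^ 13 * G := Nat.mul_le_mul_right _ p6
      linarith

end VecBound

/-! ### The renaming reduction is computable within its output size -/

/-- **The one-formula renaming machine runs in time `c · (m+1)^{n/m} · (L + n + 1)^c + c`** (in the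
sense of `ComputesInTime`, on Mathlib's `Turing.FinTM2`): the hypothesis of
`ipRename_reduceList_computable_of_single` (`IPLemma2MachineLift.lean`).
[cite: ImpagliazzoPaturiJCSS2001, Lemma 2 (p. 373), the "Moreover" sentence] -/
theorem ipRename_single (k cap len a b : ℕ) (hb : 0 < b) : ∃ c : ℕ,
    ComputesInTime KCNF.encode KCNF.encodeList (fun ψ : KCNF k => IPRename.reduceList k cap len (ipThreshold a b ψ.numVars) ψ)
      fun ψ => c * ((max len 1 + 1) ^ (ψ.numVars / max len 1) * (ψ.encode.length + ψ.numVars + 1) ^ c) + c := by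
  set K := Kc k cap len a b with hK
  set c := 2000000 * (K + 1) ^ 13 with hc
  have hc13 : 13 ≤ c := by
    have : 1 ≤ (K + 1) ^ 13 := Nat.one_le_pow _ _ (Nat.succ_pos _)
    rw [hc]; omega
  have hc1 : 1 ≤ c := by omega
  set B : KCNF k → ℕ := fun ψ => c * ((max len 1 + 1) ^ (ψ.numVars / max len 1) * (ψ.encode.length + ψ.numVars + 1) ^ c) + c - 1 with hB
  have hbound : ∀ ψ : KCNF k, ipMainCost k cap len a b ψ ≤ B ψ := by
    intro ψ
    set N := ψ.encode.length + ψ.numVars + 1 with hN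
    set G := (max len 1 + 1) ^ (ψ.numVars / max len 1) with hG
    have hN1 : 1 ≤ N := by omega
    have h1 := (sz_Ssz k cap len a b ψ).b_ipMainCost
    have hS : Ssz k cap len a b ψ ≤ (K + 1) * N := by
      have e : Ssz k cap len a b ψ = N + K := by rw [Ssz, ← hK, ← hN]
      rw [e, Nat.succ_mul]
      have : K ≤ K * N := Nat.le_mul_of_pos_right _ hN1
      omega
    have h2 : Ssz k cap len a b ψ ^ 13 ≤ (K + 1) ^ 13 * N ^ 13 := by
      rw [← mul_pow]; exact Nat.pow_le_pow_left hS 13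
    have h3 : N ^ 13 ≤ N ^ c := Nat.pow_le_pow_right hN1 hc13
    have h4 : ipMainCost k cap len a b ψ + 1 ≤ c * (G * N ^ c) := by
      have ec : c * (G * N ^ c) = 2000000 * (K + 1) ^ 13 * (G * N ^ c) := by rw [← hc]
      calc ipMainCost k cap len a b ψ + 1 ≤ 2000000 * (Ssz k cap len a b ψ ^ 13 * G) := h1
        _ ≤ 2000000 * ((K + 1) ^ 13 * N ^ 13 * G) := by gcongr
        _ ≤ 2000000 * ((K + 1) ^ 13 * N ^ c * G) := by gcongr
        _ = c * (G * N ^ c) := by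
          rw [ec]; generalize N ^ c = X; generalize (K + 1) ^ 13 = Y; ring
    rw [hB]
    show ipMainCost k cap len a b ψ ≤ c * (G * N ^ c) + c - 1
    omega
  obtain ⟨M, hM⟩ := ACom.exists_computesInTime (ipMain k cap len a b) (kr KR.inp) (kr KR.out) KCNF.encode KCNF.encodeList
    (fun ψ : KCNF k => IPRename.reduceList k cap len (ipThreshold a b ψ.numVars) ψ) B
    (fun ψ => (runs_ipMain k cap len a b hb ψ).mono (hbound ψ))
  have e : (fun ψ : KCNF k => B ψ + 1) = fun ψ => c * ((max len 1 + 1) ^ (ψ.numVars / max len 1) * (ψ.encode.length + ψ.numVars + 1) ^ c) + c := by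
    funext ψ; rw [hB]; dsimp only; omega
  rw [e] at hM
  exact ⟨c, M, hM⟩

/-- **Discharge of `ipRename_reduceList_computable`** (in the machine's namespace; the file
`IPLemma2AssemblyProofs.lean` re-exports it under the fact's own name).
[cite: ImpagliazzoPaturiJCSS2001, Lemma 2 (p. 373), the "Moreover" sentence] -/
theorem ipRename_reduceList_computable_holds' : ipRename_reduceList_computable :=
  ipRename_reduceList_computable_of_single fun k cap len a b hb => ipRename_single k cap len a b hb

end Literature.Computability.FineGrained.IPRenameM

namespace Literature.Computability.FineGrained

/-- **`ipRename_reduceList_computable` is a theorem of the tree (audit alias).** The named fact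
`ipRename_reduceList_computable` (`IPLemma2Assembly.lean`): The renaming reduction is
computable within its output size (machine half of Impagliazzo–Paturi 2001, Lemma 2, for the
explicit reduction `IPRename.reduceList` of `ForcedVariableRenaming.lean`): … — is proved by
`ipRename_reduceList_computable_holds'` (this file, primed name); this unprimed alias records
the discharge under the census/audit name `ipRename_reduceList_computable_holds` (librarian
sweep g25, pass 5c; no new mathematics).
[cite: ImpagliazzoPaturiJCSS2001, Lemma 2 (p. 373), the "Moreover" sentence] -/
theorem ipRename_reduceList_computable_holds :
    ipRename_reduceList_computable :=
  Literature.Computability.FineGrained.IPRenameM.ipRename_reduceList_computable_holds'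

end Literature.Computability.FineGrained
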